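import Summits.ResolutionOfSingularities.ResolutionOfSingularities.Theorems.MarkedTransferCampaignW46ThreefoldsReduction
import HarnessLib

/-!
# [OURS · L1 W4.6 rung (ii)] THREEFOLD HYPERSURFACES — plumbing for the component-wise reduction: the Eq. (128) anchor,
# order facts on the typed `Inv`-strings, and the topology of the terminal plat (irreducible components,
# strict transforms) — companion of `Theorems/MarkedTransferCampaignW46Threefolds.lean` v2

Cell res-hironaka, LADDER-RESOLUTION rung L (D-0089), slot W4.6, rung (ii); seat res-L1-s46-pv-3. Host route
MarkedTransfer, `--supports stmt-ResolutionOfSingularities-16156` (`HypersurfaceOrderReductionDimLeThree`).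

HONEST FRAMING. Pure logic / order theory / point-set topology over the OURS campaign definitions and the tree
(`Hironaka2017.InvStringOrder`; `Resolution.componentsIn`, `strictTransformSet` of
`Resolution.AlterationsNormalFormBlowupParts`; Mathlib Noetherian and Jacobson schemes). NOTHING here is a statement of
H. Hironaka's manuscript (2017-03-23, [Hironaka2017]) and nothing here asserts that any statement of it holds; the typed
candidate `S16Proof.Thm16_6` occurs only as the HYPOTHESIS of the anchor `equalityAlongSteps_of_thm16_6`. AI review is
weaker than expert review. No `sorry`; axioms standard.

## Contents

* `equalityAlongSteps_of_thm16_6` — anchor: part (3) of the typed candidate gives `EqualityAlongSteps N Rd Rg` for every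
  regime (companion of `decreaseAlongSteps_of_thm16_6`).
* `not_lt_zeroKey`, `not_lexLT_take`, `invStr_eq_take`, `Resume.length_invStr` — a string is never strictly below one of
  its prefixes in the 0-padded order of Eq. (127); typed strings of different lengths are prefixes of one another.
* `sUnion_componentsIn`, `strictTransformSet_eq_biUnion_componentsIn`, `IsNablaComponent.mem_componentsIn` — the terminal
  plat is the union of its finitely many irreducible components; its strict transform along one of them is the union of
  the strict transforms of the others; a ∇-component of design finding D1 is a component in the tree's sense.

## References

* tree `Resolution.AlterationsNormalFormBlowupParts` [DeJong1996, 4.27]; `Hironaka2017.InvStringOrder`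
  [BaaderNipkow1998, §2.4]; Mathlib `JacobsonSpace`, `NoetherianSpace`.
* H. Hironaka, ms. 2017-03-23: Th. 16.6 p.84 l.4–32 — scope only, under adjudication, not cited as fact. [Hironaka2017]
-/

noncomputable section

set_option linter.dupNamespace false -- mandated namespace of this single-conjunct summit

open CategoryTheory AlgebraicGeometry TopologicalSpace

namespace Summit.ResolutionOfSingularities.ResolutionOfSingularities.Theorems

namespace CampaignW46

open Literature.AlgebraicGeometry.Resolution
open Literature.AlgebraicGeometry.Hironaka2017.S02Preliminaries
open Literature.AlgebraicGeometry.Hironaka2017.Datum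
open Literature.AlgebraicGeometry.Hironaka2017.S15ARSchemes
open Literature.AlgebraicGeometry.Hironaka2017.S16Proof
open Literature.AlgebraicGeometry.Hironaka2017.InvStringOrder

universe u

variable {n : ℕ} {p : ℕ} [Fact p.Prime] {K : Type u} [Field K] [CharP K p]

/-! ## Anchor: the Eq. (128)-shape from the typed candidate -/

/-- **Anchor (pure logic).** The typed candidate Th. 16.6 (`S16Proof.Thm16_6`, any part-(4) parameter), with its
`prime` parameter read as `primeR N Rd`, implies `EqualityAlongSteps N Rd Rg` for EVERY regime (its part (3)); companion
of `decreaseAlongSteps_of_thm16_6`. The candidate occurs only as the hypothesis `h`. [folklore] -/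
theorem equalityAlongSteps_of_thm16_6 [PerfectField K] (N : Notions.{u} n) (Rd : Reading p K N)
    {pPosiEmptyAt : ∀ {W : Scheme.{u}}, IdealExponent W → W → Prop}
    (h : Thm16_6 (p := p) (K := K) n (primeR N Rd) pPosiEmptyAt) (Rg : Regime p K) : EqualityAlongSteps N Rd Rg := by
  intro A E R _ _ A' s R' hR'
  have key := h A R.mti s.D s.π (fun _ => R'.mti) R.mti_isStandard s.centre.subset_nabla s.centre.irreducible
    s.centre.smooth s.blowup ⟨A'.hom, A'.irreducible, A'.smooth, A'.quasiCompact, R', hR', fun _ => rfl⟩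
  exact key.2.2.1

/-! ## Order plumbing on the typed strings -/

section Strings

/-- Nothing lies strictly below the padding key «(0)» of Th. 16.6 (2) p.84 l.19–20. [folklore] -/
theorem not_lt_zeroKey (x : Lex (Fin (n + 2) → ℕ)) : ¬ x < (toLex fun _ => 0 : Lex (Fin (n + 2) → ℕ)) := by
  rintro ⟨i, -, hi⟩
  exact Nat.not_lt_zero _ hi

/-- A string is never strictly below one of its own prefixes in the 0-padded order `InvString.LexLT`. [folklore] -/
theorem not_lexLT_take (L : List (EdgeInv n)) (k : ℕ) : ¬ InvString.LexLT L (L.take k) := by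
  rintro ⟨i, -, hlt⟩
  by_cases hi : i < (L.take k).length
  · have hiL : i < L.length := lt_of_lt_of_le hi (by simp [List.length_take])
    rw [padKey_of_lt _ hi, padKey_of_lt _ hiL] at hlt
    simp [List.getElem_take] at hlt
  · rw [not_lt] at hi
    rw [padKey_of_length_le _ hi] at hlt
    exact not_lt_zeroKey _ hlt

/-- The typed string of length `k` is the length-`k` prefix of the typed string of any length `k' ≥ k` (both are
`(Inv_ξ(𝒴(0)), Inv_ξ(𝒴(1)), …)` truncated). [folklore] -/
theorem invStr_eq_take {Z : Scheme.{u}} (S : MTIDatum Z n) {k k' : ℕ} (h : k ≤ k') (ξ : Z) :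
    S.invStr k ξ = (S.invStr k' ξ).take k := by
  unfold MTIDatum.invStr
  rw [← List.map_take, List.take_range, Nat.min_eq_left h]

variable {N : Notions.{u} n} {A : AmbientDatum p K} {E : IdealExponent A.Z}

/-- The `Inv`-string of a résumé has length `m` (the number of stops). [folklore] -/
theorem Resume.length_invStr (R : Resume N A E) (ξ : A.Z) : (R.invStr ξ).length = R.m :=
  Literature.AlgebraicGeometry.Hironaka2017.InvStringOrder.length_invStr R.mti R.m ξ

end Strings

/-! ## Topological plumbing: the ambient is Noetherian and Jacobson; components of the terminal plat -/

section TopologyPlumbing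

/-- A subset is the union of its irreducible components (tree `Resolution.componentsIn`). [folklore] -/
theorem sUnion_componentsIn {X : Type u} [TopologicalSpace X] (S : Set X) : ⋃₀ componentsIn S = S := by
  apply Set.Subset.antisymm
  · exact Set.sUnion_subset fun E hE => componentsIn.subset hE
  · intro x hx
    obtain ⟨E, hE, hxE⟩ := componentsIn.exists_mem hx
    exact Set.mem_sUnion_of_mem hxE hE

/-- The strict transform of `S` along `D` is the union of the strict transforms of the irreducible components of `S`
other than `D` (finitely many components). [folklore] -/
theorem strictTransformSet_eq_biUnion_componentsIn {X' X : Scheme.{u}} (π : X' ⟶ X) {S : Set X} (D : Set X)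
    (hfin : (componentsIn S).Finite) :
    strictTransformSet π D S = ⋃ E' ∈ componentsIn S \ {D}, strictTransformSet π D E' := by
  have h1 : S \ D = ⋃ E' ∈ componentsIn S \ {D}, (E' \ D) := by
    ext x
    simp only [Set.mem_sdiff, Set.mem_iUnion, Set.mem_singleton_iff, exists_prop]
    constructor
    · rintro ⟨hxS, hxD⟩
      obtain ⟨E', hE', hxE'⟩ := componentsIn.exists_mem hxS
      refine ⟨E', ⟨hE', ?_⟩, hxE', hxD⟩
      rintro rfl
      exact hxD hxE'
    · rintro ⟨E', ⟨hE', -⟩, hxE', hxD⟩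
      exact ⟨componentsIn.subset hE' hxE', hxD⟩
  unfold strictTransformSet
  rw [h1, Set.preimage_iUnion₂, (hfin.sdiff).closure_biUnion]

variable {N : Notions.{u} n} {A : AmbientDatum p K} {E : IdealExponent A.Z} {R : Resume N A E}

/-- A ∇-component in the sense of D1 (`IsNablaComponent`: irreducible, maximal among irreducible subsets of `∇(E)`) is
an irreducible component of `∇(E)` in the sense of the tree's `Resolution.componentsIn`. [folklore] -/
theorem IsNablaComponent.mem_componentsIn {D : Closeds A.Z} (h : IsNablaComponent R D) :
    (D : Set A.Z) ∈ componentsIn (R.nabla : Set A.Z) := by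
  rw [mem_componentsIn_iff]
  exact ⟨h.subset_nabla, h.irreducible, fun T hT hTi hDT => (h.maximal T hTi hDT hT).le⟩

end TopologyPlumbing

end CampaignW46

end Summit.ResolutionOfSingularities.ResolutionOfSingularities.Theorems

end
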